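import Mathlib
import Summits.AtomisticToContinuum.Crystallization.Theses.ReggeStarCoercivity
import Summits.AtomisticToContinuum.Crystallization.Theorems.DefectFreeCrystallizes.Negative.PredicateAPI
import Literature.MathematicalPhysics.StatisticalMechanics.LennardJonesThermodynamicLimitProofs

/-!
# `ZeroDefectDensity` (stmt-AtomisticToContinuum-13604): sequence-free form and reduction to coercivity

Support item `ReggeStarCoercivity.ZeroDefectDensity`: along every sequence of Lennard-Jones ground
states `x^N` the fraction `#Def(x^N)/N` of `1/20`-defective first shells tends to `0`. Standing
alone this is a strong local form of three-dimensional crystallization (open, Blanc–Lewin 2015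
§2.3); the route derives it from the crux `StarCoercivity` (13600) and the trial-state bound
`CrysEnergyUpper` (11865). This helper file (supports 13604) records, sorry-free:

* `zeroDefectDensity_iff_forall_eventually` — the SEQUENCE-FREE normal form: `ZeroDefectDensity`
  holds iff for every `ε > 0`, for all large `N`, EVERY Lennard-Jones ground state of `N` particles
  has at most `ε·N` defective sites. (`→` uses existence of ground states for every `N`,
  `exists_isGroundState_lennardJones`, to splice frequently-many bad ground states into a full
  sequence.) So the item is a uniform statement about all minimisers, not about chosen sequences.
* `forall_eventually_defects_le_of_coercive` — the real-analysis engine of the route's glue, with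
  the weakest hypotheses it uses: if `limsup E(N)/N ≤ e` and every ground state obeys
  `N·e + g·#Def(x) − r(N) ≤ E_LJ(x)` with `g > 0` and `r(N)/N → 0`, then the sequence-free form
  holds (via `BlancLewin2015_8_holds`: `E(N)/N → e_∞`, whence `e_∞ ≤ e`).
* `tendsto_const_mul_rpow_two_thirds_div` — the route's boundary allowance `C·N^(2/3)` is `o(N)`.
* `zeroDefectDensity_of_starCoercivity` — `StarCoercivity → CrysEnergyUpper → ZeroDefectDensity`
  (the content of glue item 13605, three lines on top of the above): modulo this file, item 13604
  is exactly as open as the crux 13600 plus the provable-now support 11865.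
-/

noncomputable section

namespace Summit.AtomisticToContinuum.Crystallization.Theorems.ZeroDefectDensity

open Summit.AtomisticToContinuum.Crystallization.Theses.ReggeStarCoercivity
open Summit.AtomisticToContinuum.Crystallization.Theorems.DefectFreeCrystallizes.Negative.PredicateAPI
open Literature.MathematicalPhysics.StatisticalMechanics Literature.Geometry.DiscreteGeometry
open Filter Topology

/-- **Sequence-free form of `ZeroDefectDensity`.** The defect fraction tends to `0` along EVERY
sequence of Lennard-Jones ground states iff for every `ε > 0`, eventually in `N`, every ground state
of `N` particles has at most `ε·N` defective sites. The forward direction splices a frequently-bad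
choice of ground states with arbitrary ground states at the remaining `N` (they exist for every `N`:
`exists_isGroundState_lennardJones`); the backward direction is the squeeze `0 ≤ #Def/N ≤ ε/2 < ε`. -/
theorem zeroDefectDensity_iff_forall_eventually :
    ZeroDefectDensity ↔ ∀ ε : ℝ, 0 < ε → ∀ᶠ N : ℕ in atTop, ∀ x : Fin N → EuclideanSpace ℝ (Fin 3),
      IsGroundState lennardJones x → (defects x : ℝ) ≤ ε * N := by
  rw [zeroDefectDensity_iff]
  constructor
  · intro h ε hε
    by_contra hcon
    rw [Filter.not_eventually] at hcon
    -- a ground state for every `N`, bad whenever a bad one exists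
    have key : ∀ N : ℕ, ∃ y : Fin N → EuclideanSpace ℝ (Fin 3), IsGroundState lennardJones y ∧
        ((∃ x : Fin N → EuclideanSpace ℝ (Fin 3), IsGroundState lennardJones x ∧
          ε * N < (defects x : ℝ)) → ε * N < (defects y : ℝ)) := by
      intro N
      by_cases hN : ∃ x : Fin N → EuclideanSpace ℝ (Fin 3), IsGroundState lennardJones x ∧
          ε * N < (defects x : ℝ)
      · obtain ⟨x, hx, hlt⟩ := hN
        exact ⟨x, hx, fun _ => hlt⟩
      · obtain ⟨x, hx⟩ := exists_isGroundState_lennardJones (d := 3) (by norm_num) N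
        exact ⟨x, hx, fun h' => absurd h' hN⟩
    choose y hy hybad using key
    have hbad : ∃ᶠ N in atTop, ε < (defects (y N) : ℝ) / N := by
      refine (hcon.and_eventually (eventually_gt_atTop 0)).mono ?_
      rintro N ⟨hN, hN0⟩
      push Not at hN
      obtain ⟨x, hx, hlt⟩ := hN
      have hN0' : (0 : ℝ) < N := by exact_mod_cast hN0
      rw [lt_div_iff₀ hN0']
      exact hybad N ⟨x, hx, hlt⟩
    have hev : ∀ᶠ N in atTop, (defects (y N) : ℝ) / N < ε :=
      (h y hy).eventually (gt_mem_nhds hε)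
    obtain ⟨N, h1, h2⟩ := (hbad.and_eventually hev).exists
    exact lt_irrefl _ (h1.trans h2)
  · intro h x hx
    rw [Metric.tendsto_nhds]
    intro ε hε
    filter_upwards [h (ε / 2) (half_pos hε)] with N hN
    rw [Real.dist_0_eq_abs, abs_of_nonneg (div_nonneg (Nat.cast_nonneg _) (Nat.cast_nonneg _))]
    rcases Nat.eq_zero_or_pos N with hN0 | hN0
    · subst hN0
      simp [hε]
    · have hN0' : (0 : ℝ) < N := by exact_mod_cast hN0
      rw [div_lt_iff₀ hN0']
      have := hN (x N) (hx N)
      nlinarith [this, hε, hN0']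

/-- **Coercivity at (or above) the thermodynamic limit forces vanishing defect density** (sequence-free
form; combine with `zeroDefectDensity_iff_forall_eventually`). If `limsup E(N)/N ≤ e` and every
Lennard-Jones ground state `x` of `N` particles satisfies `N·e + g·#Def(x) − r(N) ≤ E_LJ(x)` with
`g > 0` and `r(N)/N → 0`, then for every `ε > 0`, eventually in `N`, every ground state has
`#Def ≤ ε·N`. Proof: `E(N)/N → e_∞` (`BlancLewin2015_8_holds`, Fekete), so `e_∞ = limsup ≤ e`; for a
ground state `E_LJ(x) = E(N)`, hence `g·#Def(x) ≤ N(E(N)/N − e) + r(N) < N·(gε/2) + N·(gε/2)` for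
large `N`. (Stated with this conclusion rather than `ZeroDefectDensity` itself so that no registered
obligation is concluded under unregistered hypotheses, D-0027 §2.1.) -/
theorem forall_eventually_defects_le_of_coercive {e g : ℝ} {r : ℕ → ℝ} (hg : 0 < g)
    (hr : Tendsto (fun N : ℕ => r N / N) atTop (𝓝 0))
    (hlim : limsup (fun N : ℕ => groundStateEnergy lennardJones 3 N / N) atTop ≤ e)
    (hco : ∀ (N : ℕ) (x : Fin N → EuclideanSpace ℝ (Fin 3)), IsGroundState lennardJones x →
      (N : ℝ) * e + g * (defects x : ℝ) - r N ≤ interactionEnergy lennardJones x) :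
    ∀ ε : ℝ, 0 < ε → ∀ᶠ N : ℕ in atTop, ∀ x : Fin N → EuclideanSpace ℝ (Fin 3),
      IsGroundState lennardJones x → (defects x : ℝ) ≤ ε * N := by
  intro ε hε
  obtain ⟨einf, -, htend, -⟩ := BlancLewin2015_8_holds 3 (by norm_num) (by norm_num)
  have hle : einf ≤ e := htend.limsup_eq.ge.trans hlim
  have hgε : 0 < g * ε / 2 := by positivity
  have h1 : ∀ᶠ N : ℕ in atTop, groundStateEnergy lennardJones 3 N / N < einf + g * ε / 2 :=
    htend.eventually (gt_mem_nhds (by linarith))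
  have h2 : ∀ᶠ N : ℕ in atTop, r N / N < g * ε / 2 := hr.eventually (gt_mem_nhds hgε)
  filter_upwards [h1, h2, eventually_gt_atTop 0] with N hN1 hN2 hN0 x hx
  have hN : (0 : ℝ) < N := by exact_mod_cast hN0
  have hc := hco N x hx
  rw [hx.2] at hc
  rw [div_lt_iff₀ hN] at hN1 hN2
  have h3 : einf * N ≤ e * N := mul_le_mul_of_nonneg_right hle hN.le
  have h4 : g * (defects x : ℝ) < g * (ε * N) := by nlinarith [hc, hN1, hN2, h3]
  exact (lt_of_mul_lt_mul_left h4 hg.le).le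

/-- The route's boundary allowance is sublinear: `C·N^(2/3)/N = C·N^(−1/3) → 0`. [folklore] -/
theorem tendsto_const_mul_rpow_two_thirds_div (C : ℝ) :
    Tendsto (fun N : ℕ => C * (N : ℝ) ^ (2 / 3 : ℝ) / N) atTop (𝓝 0) := by
  have h : Tendsto (fun N : ℕ => C * ((N : ℝ) ^ (-(1 / 3 : ℝ)))) atTop (𝓝 (C * 0)) :=
    ((tendsto_rpow_neg_atTop (by norm_num : (0 : ℝ) < 1 / 3)).comp
      tendsto_natCast_atTop_atTop).const_mul C
  rw [mul_zero] at h
  refine h.congr' ?_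
  filter_upwards [eventually_gt_atTop 0] with N hN
  have hN : (N : ℝ) ≠ 0 := by exact_mod_cast hN.ne'
  have hexp : (2 / 3 : ℝ) - 1 = -(1 / 3 : ℝ) := by norm_num
  rw [mul_div_assoc, ← Real.rpow_sub_one hN, hexp]

/-- **`StarCoercivity → CrysEnergyUpper → ZeroDefectDensity`** (the glue of the route, item 13605's
content, on top of `forall_eventually_defects_le_of_coercive`): a ground state is injective, so `StarCoercivity`
applies to it with `e = e_per = ⨅_Q e(Q)` and `r(N) = C·N^(2/3)`; `CrysEnergyUpper` is literally
`limsup E(N)/N ≤ e_per`. Hence item 13604 stands or falls with the crux 13600 (given 11865). -/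
theorem zeroDefectDensity_of_starCoercivity (hX : StarCoercivity) (hUp : CrysEnergyUpper) :
    ZeroDefectDensity := by
  obtain ⟨g, hg, C, h⟩ := hX
  exact zeroDefectDensity_iff_forall_eventually.2 <|
    forall_eventually_defects_le_of_coercive
      (e := ⨅ Q : PeriodicConfiguration 3, Q.energyPerParticle lennardJones)
      (r := fun N => C * (N : ℝ) ^ (2 / 3 : ℝ)) hg (tendsto_const_mul_rpow_two_thirds_div C) hUp
      fun N x hx => h N x hx.1

end Summit.AtomisticToContinuum.Crystallization.Theorems.ZeroDefectDensity

end
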